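import Summits.CriticalPhenomena.Ising3DConformalLimit.Theorems.EnergyNotSigmaSquaredGapForcesFarMergingSandwichTailTightnessAux
import HarnessLib

/-!
# First moment of the annulus-meeting probability of the one-pinch system
# (line `one-cluster-depletion-sandwich` of crux `GapForcesFarMerging`, item stmt-CriticalPhenomena-4468;
# helper file for the registered stub `stub_meetDomination`)

For the four-trace law `fourTraceLaw n y = P^{y₀y₁,∅}_{Λ_n} ⊗ P^{y₂y₃,∅}_{Λ_n}` (two INDEPENDENT duplicated clusters
`C₁ = C_{n₁+n₂}(y₀)`, `C₂ = C_{n₃+n₄}(y₂)` of the free box `Λ_n ⊂ ℤ³` at `β_c`) and a finite set of sites `A ⊆ Λ_n`,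
`P[C₁ ∩ C₂ ∩ A ≠ ∅] ≤ ∑_{v ∈ A} ρ_n(y₀,y₁;v) ρ_n(y₂,y₃;v)` (union bound over the common vertex, `Measure.prod_prod`, and
the exact one-point densities `ρ_n(a,b;v) = G_n(a,v)G_n(v,b)/G_n(a,b)` of `TailTightnessProof.law_real_openConn_eq`);
specialised to the one-pinch quadruple `pinch K` and the annulus `Λ_{2^k} ∖ Λ_{2^{k-1}}`:
`meetAnn n k K ≤ ∑_{v ∈ Λ_{2^k}∖Λ_{2^{k-1}}} ρ_n(0,p_K;v) ρ_n(e₂,q_K;v)` once `2^k, 2^K ≤ n`. With `c‖x‖⁻² ≤ G ≤ C‖x‖⁻¹`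
this first moment is `≤ C'·16^K/2^k` — small only for `k ≥ 4K + O(1)`; it is NOT the route to `MeetDomination` (whose
content is the re-rooted comparison of the sibling helper files), only its trivial far tail.
Everything is proved; no definition and no named fact is introduced. The registered helper is the last theorem
`meetDomination_firstMoment`.

References: M. Aizenman, H. Duminil-Copin, Ann. of Math. 194 (2021) = arXiv:1912.07973, §4.2 (proof of Lemma 4.4,
first moment of `|𝓜|`), App. A Prop. A.3 [AizenmanDuminilCopinAnnals2021].
-/

noncomputable section

namespace Summit.CriticalPhenomena.Ising3DConformalLimit.EnergyNotSigmaSquaredGapForcesFarMergingSandwich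

namespace MeetDominationProof

open scoped symmDiff ENNReal Topology
open MeasureTheory Filter
open Literature.Probability.LatticeModels Literature.Probability.Percolation
open Summit.CriticalPhenomena.Ising3DConformalLimit.GapForcesFarMergingSandwich
open Summit.CriticalPhenomena.Ising3DConformalLimit.Cruxes.IsingEuclidUpgradeR4NonGaussian.FreeCovarianceDeltaDichotomy
  (threePointRatio)

/-! ## §1. First moment of a localized meeting -/

/-- **First moment of a localized meeting** (union bound over the common vertex, independence, and the exact
one-point densities): for a quadruple `y ⊂ Λ_n` and a finite set `A ⊆ Λ_n`,
`P[C_{n₁+n₂}(y₀) ∩ C_{n₃+n₄}(y₂) ∩ A ≠ ∅] ≤ ∑_{v ∈ A} ρ_n(y₀,y₁;v) ρ_n(y₂,y₃;v)`.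
[cite: AizenmanDuminilCopinAnnals2021, §4.2, proof of Lemma 4.4 (first moment of |𝓜|)] -/
theorem real_meetSet_le_sum {n : ℕ} {y : Fin 4 → Site 3} (hy : ∀ i, y i ∈ box 3 n)
    {A : Finset (Site 3)} (hA : A ⊆ box 3 n) :
    (fourTraceLaw n y).real {ω | ∃ u ∈ A, u ∈ openCluster ω.1 (y 0) ∧ u ∈ openCluster ω.2 (y 2)} ≤
      ∑ v ∈ A, threePointRatio n (y 0) (y 1) v * threePointRatio n (y 2) (y 3) v := by
  haveI := TailTightnessProof.isProbabilityMeasure_law (hy 0) (hy 1)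
  haveI := TailTightnessProof.isProbabilityMeasure_law (hy 2) (hy 3)
  haveI : IsProbabilityMeasure (fourTraceLaw n y) := TailTightnessProof.isProbabilityMeasure_fourTraceLaw hy
  set F : Site 3 → Set (BondConfig (Site 3) × BondConfig (Site 3)) := fun v =>
    (openConn (y 0) v : Set (BondConfig (Site 3))) ×ˢ (openConn (y 2) v : Set (BondConfig (Site 3)))
    with hFdef
  have hsub : {ω : BondConfig (Site 3) × BondConfig (Site 3) |
      ∃ u ∈ A, u ∈ openCluster ω.1 (y 0) ∧ u ∈ openCluster ω.2 (y 2)} ⊆ ⋃ v ∈ A, F v := by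
    rintro ω ⟨u, huA, hu1, hu2⟩
    exact Set.mem_iUnion₂.2 ⟨u, huA, Set.mk_mem_prod hu1 hu2⟩
  calc (fourTraceLaw n y).real {ω | ∃ u ∈ A, u ∈ openCluster ω.1 (y 0) ∧ u ∈ openCluster ω.2 (y 2)}
      ≤ (fourTraceLaw n y).real (⋃ v ∈ A, F v) := measureReal_mono hsub (measure_ne_top _ _)
    _ ≤ ∑ v ∈ A, (fourTraceLaw n y).real (F v) := measureReal_biUnion_finset_le _ F
    _ = ∑ v ∈ A, threePointRatio n (y 0) (y 1) v * threePointRatio n (y 2) (y 3) v := by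
        refine Finset.sum_congr rfl fun v hv => ?_
        rw [measureReal_def, fourTraceLaw, hFdef, Measure.prod_prod, ENNReal.toReal_mul, ← measureReal_def,
          ← measureReal_def, TailTightnessProof.law_real_openConn_eq (hy 0) (hy 1) (hA hv),
          TailTightnessProof.law_real_openConn_eq (hy 2) (hy 3) (hA hv)]

/-! ## §2. The one-pinch system at far octave `K`, annulus `Λ_{2^k} ∖ Λ_{2^{k-1}}` -/

/-- The four points of the one-pinch quadruple lie in `Λ_n` as soon as `2^K ≤ n`. [folklore] -/
theorem pinch_mem_box {K n : ℕ} (hn : 2 ^ K ≤ n) (i : Fin 4) : pinch K i ∈ box 3 n := by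
  have h1 : (1 : ℤ) ≤ 2 ^ K := one_le_pow₀ (by norm_num)
  have h2 : ((2 : ℤ) ^ K) ≤ n := by exact_mod_cast hn
  fin_cases i <;> simp only [pinch, pFar, qFar, mem_box] <;> intro j <;> fin_cases j <;> simp <;> omega

/-- The annulus `Λ_{2^k} ∖ Λ_{2^{k-1}}` lies in `Λ_n` as soon as `2^k ≤ n`. [folklore] -/
theorem ann_subset_box {k n : ℕ} (hn : 2 ^ k ≤ n) : box 3 (2 ^ k) \ box 3 (2 ^ (k - 1)) ⊆ box 3 n :=
  fun _ hv => box_mono 3 hn (Finset.mem_sdiff.1 hv).1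

/-- **First moment of the annulus meeting probability of the one-pinch system**: for `2^k, 2^K ≤ n`,
`meetAnn n k K ≤ ∑_{v ∈ Λ_{2^k} ∖ Λ_{2^{k-1}}} ρ_n(0,p_K;v) ρ_n(e₂,q_K;v)`.
[cite: AizenmanDuminilCopinAnnals2021, §4.2, proof of Lemma 4.4 (first moment of |𝓜|)] -/
theorem meetAnn_le_sum {n k K : ℕ} (hk : 2 ^ k ≤ n) (hK : 2 ^ K ≤ n) :
    meetAnn n k K ≤ ∑ v ∈ box 3 (2 ^ k) \ box 3 (2 ^ (k - 1)),
      threePointRatio n 0 (pFar K) v * threePointRatio n e₂ (qFar K) v :=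
  real_meetSet_le_sum (pinch_mem_box hK) (ann_subset_box hk)

/-- Eventually in the box size, `Λ_n` contains the annulus and the four pinch points. [folklore] -/
theorem eventually_scales_le (k K : ℕ) : ∀ᶠ n : ℕ in atTop, 2 ^ k ≤ n ∧ 2 ^ K ≤ n :=
  (eventually_ge_atTop (2 ^ k)).and (eventually_ge_atTop (2 ^ K))

/-- **First moment, eventually in `n`**: `meetAnn n k K ≤ ∑_{v ∈ Λ_{2^k}∖Λ_{2^{k-1}}} ρ_n(0,p_K;v) ρ_n(e₂,q_K;v)` for all
large `n`. [cite: AizenmanDuminilCopinAnnals2021, §4.2, proof of Lemma 4.4 (first moment of |𝓜|)] -/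
theorem eventually_meetAnn_le_sum (k K : ℕ) : ∀ᶠ n : ℕ in atTop,
    meetAnn n k K ≤ ∑ v ∈ box 3 (2 ^ k) \ box 3 (2 ^ (k - 1)),
      threePointRatio n 0 (pFar K) v * threePointRatio n e₂ (qFar K) v := by
  filter_upwards [eventually_scales_le k K] with n hn using meetAnn_le_sum hn.1 hn.2

end MeetDominationProof

open MeasureTheory Filter
open Literature.Probability.LatticeModels Literature.Probability.Percolation
open Summit.CriticalPhenomena.Ising3DConformalLimit.GapForcesFarMergingSandwich
open Summit.CriticalPhenomena.Ising3DConformalLimit.Cruxes.IsingEuclidUpgradeR4NonGaussian.FreeCovarianceDeltaDichotomy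
  (threePointRatio)

/-- **Registered helper `meetDomination_firstMoment`** (first moment of the annulus-meeting probability of the one-pinch
system, eventually in the box size, helper for `stub_meetDomination`):
`meetAnn n k K ≤ ∑_{v ∈ Λ_{2^k}∖Λ_{2^{k-1}}} ρ_n(0,p_K;v) ρ_n(e₂,q_K;v)` for all large `n`.
[cite: AizenmanDuminilCopinAnnals2021, §4.2, proof of Lemma 4.4 (first moment of |𝓜|)] -/
theorem meetDomination_firstMoment : ∀ k K : ℕ, ∀ᶠ n : ℕ in atTop, meetAnn n k K ≤ ∑ v ∈ box 3 (2 ^ k) \ box 3 (2 ^ (k - 1)), threePointRatio n 0 (pFar K) v * threePointRatio n e₂ (qFar K) v :=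
  MeetDominationProof.eventually_meetAnn_le_sum

end Summit.CriticalPhenomena.Ising3DConformalLimit.EnergyNotSigmaSquaredGapForcesFarMergingSandwich

end
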